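import Mathlib.NumberTheory.LocalField.Basic
import Mathlib.Topology.Algebra.Module.FiniteDimension
import Mathlib.Topology.Algebra.Algebra
import Mathlib.LinearAlgebra.FreeModule.PID
import Mathlib.LinearAlgebra.Basis.Submodule
import Mathlib.LinearAlgebra.Dimension.Free
import Mathlib.RingTheory.Filtration
import Mathlib.Analysis.Normed.Group.Ultra
import Literature.NumberTheory.GaloisRepresentations.PadicAlgebraIntegral
import Literature.NumberTheory.GaloisRepresentations.LocalOneUnitsStructureProofs
import HarnessLib

/-!
# `𝒪_K ≅ ℤ_p^{[K:ℚ_p]}`, `#(𝒪_K / p) = p^{[K:ℚ_p]}` and `U₂ = 1 + p²𝒪_K ≃ ℤ_p^{[K:ℚ_p]}` for an MLF `K`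

Proof-only file (no definitions, no named facts).  For a finite extension `K` of `ℚ_p` carrying
its structure of non-archimedean local field (Mathlib `IsNonarchimedeanLocalField`, the tree's
valued model; the `ℚ_p`-algebra structure is automatically the canonical continuous one,
`LocalField.continuous_of_ringHom_padic`) we PROVE the three classical structure statements about
the ring of integers `𝒪_K` and its units that S. Mochizuki's rank computations rest on
([AbsTopI] Thm 2.6 (ii) p. 21 "`δ¹_p(G_k) = [k : ℚ_p] + 1` … well-known … local class field
theory"; [AbsAnab] Lemma 1.1.4 (ii) proof p. 8 "`[K′ : ℚ_p] = dim_{ℚ_p}((G′)^{ab} ⊗ ℚ_p) − …`",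
via `G_K^{ab} ≅ (K^×)^∧` and `K^× ≅ ℤ × 𝒪_K^×`):

* `nonempty_addEquiv_integer_pi` — `(𝒪_K, +) ≃ ℤ_p^d`, `d = [K : ℚ_p]` (Neukirch, *Algebraic
  Number Theory* II (5.7) "`𝒪_K` is a free `ℤ_p`-module of rank `[K:ℚ_p]`"): the
  `ℤ_p`-span `M` of a `ℚ_p`-basis of `K` chosen inside `𝒪_K` is OPEN (its membership is cut out
  by the continuous coordinate functionals) hence of finite index `N` in the compact `𝒪_K`, so
  `N·𝒪_K ⊆ M ≅ ℤ_p^d` and `𝒪_K` is a finitely generated torsion-free — hence free — `ℤ_p`-module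
  squeezed between two lattices of rank `d`;
* `natCard_integer_quot_span_prime` — `#(𝒪_K / p𝒪_K) = p^{[K:ℚ_p]}` (reduce `ℤ_p^d` modulo `p`
  coordinatewise);
* `exists_oneUnits_continuousMulEquiv` — there is an open subgroup of finite index
  `U₂ ≤ 𝒪_K^×` with `U₂ ≃ₜ* ℤ_p^{[K:ℚ_p]}` (Neukirch II (5.7) (i) "`U^{(n)} ≅ ℤ_p^d` for `n`
  large"): the tree's logarithm-free structure theorem for higher one-units of compact `p`-adic
  rings (`OneUnits.exists_subgroup_continuousMulEquiv`, `LocalOneUnitsStructureProofs.lean`,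
  which gives `U₂ ≃ₜ* ℤ_pⁿ` with `pⁿ = #(𝒪_K/p)`) combined with the previous item.

HONEST FRAMING: classical and undisputed (Neukirch II §5; Serre, *Local Fields* II §2, IV §2);
nothing here bears on [IUTchIII] Cor. 3.12.
-/

noncomputable section

open ValuativeRel Topology Filter

namespace Literature.AnabelianGeometry.AbsoluteAnabelian

open Literature.NumberTheory.GaloisRepresentations

variable (p : ℕ) [Fact p.Prime]
variable (K : Type*) [Field K] [ValuativeRel K] [TopologicalSpace K] [IsNonarchimedeanLocalField K]
  [Algebra ℚ_[p] K] [FiniteDimensional ℚ_[p] K]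

/-- **`(𝒪_K, +) ≅ ℤ_p^{[K:ℚ_p]}`** for a finite extension `K/ℚ_p` (as a local field): the ring of
integers is a free `ℤ_p`-module of rank `[K : ℚ_p]`.  Proof: a `ℚ_p`-basis of `K` scaled into
`𝒪_K` spans an open `ℤ_p`-lattice `M ≤ 𝒪_K`; `𝒪_K` is compact, so `[𝒪_K : M] = N < ∞`, and
`N · 𝒪_K ≤ M ≅ ℤ_p^d` makes `𝒪_K` finitely generated and torsion-free over the PID `ℤ_p`, hence
free, of rank exactly `d`.  (Neukirch, *Algebraic Number Theory* II §5; the input of [AbsTopI]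
Thm 2.6 (ii)'s "`δ¹_p(G_k) = [k : ℚ_p] + 1`".) [cite: MochizukiAbsTopI2012, Thm 2.6 (ii) p.21] -/
theorem nonempty_addEquiv_integer_pi :
    Nonempty (𝒪[K] ≃+ (Fin (Module.finrank ℚ_[p] K) → ℤ_[p])) := by
  classical
  have hp : p.Prime := Fact.out
  haveI : CharZero K := charZero_of_injective_algebraMap (algebraMap ℚ_[p] K).injective
  set d := Module.finrank ℚ_[p] K with hd_def
  -- the `ℤ_p`-module structure on `K`
  letI : Algebra ℤ_[p] K := ((algebraMap ℚ_[p] K).comp (algebraMap ℤ_[p] ℚ_[p])).toAlgebra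
  haveI : IsScalarTower ℤ_[p] ℚ_[p] K := IsScalarTower.of_algebraMap_eq (fun _ => rfl)
  have hinjZ : Function.Injective (algebraMap ℤ_[p] K) :=
    (algebraMap ℚ_[p] K).injective.comp Subtype.val_injective
  haveI : FaithfulSMul ℤ_[p] K := (faithfulSMul_iff_algebraMap_injective ℤ_[p] K).mpr hinjZ
  haveI : Module.IsTorsionFree ℤ_[p] K := inferInstance
  -- topology: `K` is a Hausdorff topological `ℚ_p`-vector space
  have hcont : Continuous (algebraMap ℚ_[p] K) :=
    LocalField.continuous_of_ringHom_padic (algebraMap ℚ_[p] K)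
  haveI : ContinuousSMul ℚ_[p] K := continuousSMul_of_algebraMap ℚ_[p] K hcont
  haveI : T2Space K := by
    apply IsTopologicalAddGroup.t2Space_of_zero_sep
    intro x hx
    refine ⟨{ z | valuation K z < valuation K x }, ?_, by simp⟩
    rw [IsValuativeTopology.mem_nhds_zero_iff]
    exact ⟨Units.mk0 (valuation K x) (by simpa using hx), subset_rfl⟩
  -- `𝒪_K` as a `ℤ_p`-submodule of `K`
  have hval_int : ∀ a : ℤ_[p], valuation K (algebraMap ℤ_[p] K a) ≤ 1 := fun a =>
    LocalField.valuation_algebraMap_padicInt_le_one (K := K) a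
  let O : Submodule ℤ_[p] K :=
    { carrier := 𝒪[K]
      add_mem' := fun ha hb => add_mem ha hb
      zero_mem' := zero_mem _
      smul_mem' := fun a x hx => by
        have hx' : valuation K x ≤ 1 := hx
        change valuation K (a • x) ≤ 1
        rw [Algebra.smul_def, map_mul]
        exact mul_le_one' (hval_int a) hx' }
  have hO_mem : ∀ x : K, x ∈ O ↔ x ∈ 𝒪[K] := fun x => Iff.rfl
  -- a `ℚ_p`-basis of `K` inside `𝒪_K`
  let b₀ : Module.Basis (Fin d) ℚ_[p] K := Module.finBasis ℚ_[p] K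
  have hOopen : IsOpen ((𝒪[K] : Subring K) : Set K) := Valuation.isOpen_integer
  have hscale : ∀ i : Fin d, ∃ k : ℕ, ((p : ℚ_[p]) ^ k) • b₀ i ∈ 𝒪[K] := by
    intro i
    have hlt : ‖(p : ℚ_[p])‖ < 1 := Padic.norm_p_lt_one
    have ht : Tendsto (fun k : ℕ => ((p : ℚ_[p]) ^ k) • b₀ i) atTop (𝓝 0) := by
      have h0 := tendsto_pow_atTop_nhds_zero_of_norm_lt_one hlt
      simpa using h0.smul_const (b₀ i)
    have hmem : ((𝒪[K] : Subring K) : Set K) ∈ 𝓝 (0 : K) := hOopen.mem_nhds (zero_mem _)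
    exact (ht.eventually_mem hmem).exists
  choose k hk using hscale
  have hp0 : (p : ℚ_[p]) ≠ 0 := by exact_mod_cast hp.ne_zero
  let u : Fin d → ℚ_[p]ˣ := fun i => Units.mk0 ((p : ℚ_[p]) ^ k i) (pow_ne_zero _ hp0)
  let b : Module.Basis (Fin d) ℚ_[p] K := b₀.unitsSMul u
  have hb : ∀ i, b i ∈ O := by
    intro i
    rw [hO_mem]
    have : b i = ((p : ℚ_[p]) ^ k i) • b₀ i := by
      simp [b, Module.Basis.unitsSMul_apply, u]
    rw [this]
    exact hk i
  -- the lattice `M = ∑ ℤ_p bᵢ ≤ 𝒪_K`, free of rank `d`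
  let M : Submodule ℤ_[p] K := Submodule.span ℤ_[p] (Set.range b)
  have hMO : M ≤ O := Submodule.span_le.mpr (by rintro _ ⟨i, rfl⟩; exact hb i)
  let bM : Module.Basis (Fin d) ℤ_[p] M := b.restrictScalars ℤ_[p]
  haveI : Module.Finite ℤ_[p] M := Module.Finite.of_basis bM
  -- `M` is open: membership is cut out by the continuous coordinates
  have hMopen : IsOpen (M : Set K) := by
    have hset : (M : Set K) = ⋂ i : Fin d, (fun x => b.repr x i) ⁻¹' {a : ℚ_[p] | ‖a‖ ≤ 1} := by
      ext x
      simp only [SetLike.mem_coe, Set.mem_iInter, Set.mem_preimage, Set.mem_setOf_eq]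
      rw [b.mem_span_iff_repr_mem ℤ_[p] x]
      refine forall_congr' fun i => ?_
      constructor
      · rintro ⟨a, ha⟩
        rw [← ha]
        exact a.2
      · intro h
        exact ⟨⟨b.repr x i, h⟩, rfl⟩
    rw [hset]
    refine isOpen_iInter_of_finite fun i => ?_
    have hci : Continuous fun x => b.repr x i := (b.coord i).continuous_of_finiteDimensional
    have hball : IsOpen {a : ℚ_[p] | ‖a‖ ≤ 1} := by
      have : {a : ℚ_[p] | ‖a‖ ≤ 1} = Metric.closedBall 0 1 := by
        ext a; simp
      rw [this]
      exact IsUltrametricDist.isOpen_closedBall 0 one_ne_zero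
    exact hball.preimage hci
  -- `𝒪_K` is compact, so `M` has finite index `N` in it
  have hOc : IsCompact (O : Set K) := by
    have h := IsNonarchimedeanLocalField.isCompact_closedBall K 1
    have hset : (O : Set K) = {x | valuation K x ≤ 1} := by
      ext x
      rfl
    rw [hset]
    exact h
  haveI : CompactSpace O := isCompact_iff_compactSpace.mp hOc
  let M' : AddSubgroup O := M.toAddSubgroup.addSubgroupOf O.toAddSubgroup
  have hM'open : IsOpen (M' : Set O) := by
    have : (M' : Set O) = ((↑) : O → K) ⁻¹' (M : Set K) := by
      ext x; rfl
    rw [this]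
    exact hMopen.preimage continuous_subtype_val
  haveI : Finite (O ⧸ M') := AddSubgroup.quotient_finite_of_isOpen M' hM'open
  haveI hM'fi : M'.FiniteIndex := AddSubgroup.finiteIndex_of_finite_quotient
  set N : ℕ := M'.index with hN_def
  have hN0 : N ≠ 0 := hM'fi.index_ne_zero
  have hNmem : ∀ x : O, (N : ℤ_[p]) • (x : K) ∈ M := by
    intro x
    have h1 : N • x ∈ M' := AddSubgroup.nsmul_index_mem M' x
    rw [AddSubgroup.mem_addSubgroupOf] at h1
    have h2 : ((N • x : O) : K) ∈ M := h1
    rw [Nat.cast_smul_eq_nsmul]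
    simpa using h2
  -- `x ↦ N x : 𝒪_K → M` is an injective `ℤ_p`-linear map
  let φ : O →ₗ[ℤ_[p]] M := ((N : ℤ_[p]) • O.subtype).codRestrict M (fun x => hNmem x)
  have hφ : Function.Injective φ := by
    intro x y hxy
    have h1 : (N : ℤ_[p]) • (x : K) = (N : ℤ_[p]) • (y : K) := by
      simpa [φ] using congrArg (Subtype.val : M → K) hxy
    have hN0' : (N : ℤ_[p]) ≠ 0 := by exact_mod_cast hN0
    exact Subtype.ext (smul_right_injective K hN0' h1)
  haveI : Module.Finite ℤ_[p] O := Module.Finite.of_injective φ hφ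
  haveI : Module.IsTorsionFree ℤ_[p] O := inferInstance
  haveI : Module.Free ℤ_[p] O := Module.free_of_finite_type_torsion_free'
  -- rank `d`
  have h1 : Module.finrank ℤ_[p] O ≤ d := by
    have := LinearMap.finrank_le_finrank_of_injective hφ
    rwa [Module.finrank_eq_card_basis bM, Fintype.card_fin] at this
  have h2 : d ≤ Module.finrank ℤ_[p] O := by
    have := LinearMap.finrank_le_finrank_of_injective (Submodule.inclusion_injective hMO)
    rwa [Module.finrank_eq_card_basis bM, Fintype.card_fin] at this
  have hd : Module.finrank ℤ_[p] O = d := le_antisymm h1 h2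
  let bO : Module.Basis (Fin d) ℤ_[p] O := Module.finBasisOfFinrankEq ℤ_[p] O hd
  let e : O ≃ₗ[ℤ_[p]] (Fin d → ℤ_[p]) := bO.equivFun
  -- transfer along the identity of carriers `𝒪_K = O`
  let ι : 𝒪[K] ≃+ O :=
    { toFun := fun x => ⟨x.1, (hO_mem x.1).mpr x.2⟩
      invFun := fun x => ⟨x.1, (hO_mem x.1).mp x.2⟩
      left_inv := fun x => rfl
      right_inv := fun x => rfl
      map_add' := fun x y => rfl }
  exact ⟨ι.trans e.toAddEquiv⟩

/-- **`#(𝒪_K / p 𝒪_K) = p^{[K:ℚ_p]}`** for a finite extension `K/ℚ_p` (as a local field):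
reduce `𝒪_K ≅ ℤ_p^d` modulo `p` coordinatewise (`ℤ_p/p = 𝔽_p`).  This is the integer `n`
with `pⁿ = #(𝒪_K/p)` of the tree's one-unit structure theorem, identified with `[K : ℚ_p]`
as [AbsTopI] Thm 2.6 (ii) requires. [cite: MochizukiAbsTopI2012, Thm 2.6 (ii) p.21] -/
theorem natCard_integer_quot_span_prime :
    Nat.card (𝒪[K] ⧸ Ideal.span {(p : 𝒪[K])}) = p ^ Module.finrank ℚ_[p] K := by
  classical
  have hp : p.Prime := Fact.out
  obtain ⟨e⟩ := nonempty_addEquiv_integer_pi p K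
  set d := Module.finrank ℚ_[p] K with hd_def
  -- coordinatewise reduction modulo `p`
  let ψ : (Fin d → ℤ_[p]) →+ (Fin d → ZMod p) :=
    AddMonoidHom.compLeft (PadicInt.toZMod (p := p)).toAddMonoidHom (Fin d)
  let Φ : 𝒪[K] →+ (Fin d → ZMod p) := ψ.comp e.toAddMonoidHom
  have hψ_apply : ∀ (f : Fin d → ℤ_[p]) (i : Fin d), ψ f i = PadicInt.toZMod (f i) := fun f i => rfl
  have hsurj : Function.Surjective Φ := by
    intro t
    have hts : Function.Surjective (PadicInt.toZMod (p := p)) :=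
      ZMod.ringHom_surjective _
    have hψs : Function.Surjective ψ := fun g =>
      ⟨fun i => (hts (g i)).choose, funext fun i => (hts (g i)).choose_spec⟩
    obtain ⟨f, hf⟩ := hψs t
    exact ⟨e.symm f, by simp [Φ, hf]⟩
  -- kernel of `Φ` = `p 𝒪_K`
  have hker_toZMod : ∀ a : ℤ_[p], PadicInt.toZMod a = 0 ↔ ∃ c : ℤ_[p], a = p * c := by
    intro a
    rw [← RingHom.mem_ker, PadicInt.ker_toZMod, PadicInt.maximalIdeal_eq_span_p,
      Ideal.mem_span_singleton]
    constructor
    · rintro ⟨c, rfl⟩; exact ⟨c, rfl⟩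
    · rintro ⟨c, rfl⟩; exact ⟨c, rfl⟩
  have hmul_e : ∀ y : 𝒪[K], e ((p : 𝒪[K]) * y) = fun i => (p : ℤ_[p]) * e y i := by
    intro y
    have : ((p : 𝒪[K]) * y) = p • y := by rw [nsmul_eq_mul]
    rw [this, map_nsmul]
    funext i
    simp [nsmul_eq_mul]
  have hker : ∀ x : 𝒪[K], Φ x = 0 ↔ x ∈ Ideal.span {(p : 𝒪[K])} := by
    intro x
    rw [Ideal.mem_span_singleton']
    constructor
    · intro hx
      have hx' : ∀ i, ∃ c : ℤ_[p], e x i = p * c := by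
        intro i
        have : Φ x i = 0 := by rw [hx]; rfl
        exact (hker_toZMod _).mp this
      choose c hc using hx'
      refine ⟨e.symm c, ?_⟩
      apply e.injective
      rw [mul_comm, hmul_e, e.apply_symm_apply]
      funext i
      exact (hc i).symm
    · rintro ⟨y, rfl⟩
      funext i
      change ψ (e (y * (p : 𝒪[K]))) i = 0
      rw [hψ_apply, mul_comm, hmul_e]
      exact (hker_toZMod _).mpr ⟨e y i, rfl⟩
  have hker_eq : Φ.ker = (Ideal.span {(p : 𝒪[K])}).toAddSubgroup := by
    ext x
    rw [AddMonoidHom.mem_ker, hker]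
    rfl
  -- count
  have hcard_target : Nat.card (Fin d → ZMod p) = p ^ d := by
    rw [Nat.card_eq_fintype_card, Fintype.card_pi, Finset.prod_const, ZMod.card,
      Finset.card_univ, Fintype.card_fin]
  calc Nat.card (𝒪[K] ⧸ Ideal.span {(p : 𝒪[K])})
      = (Ideal.span {(p : 𝒪[K])}).toAddSubgroup.index := rfl
    _ = Φ.ker.index := by rw [hker_eq]
    _ = Nat.card Φ.range := AddSubgroup.index_ker Φ
    _ = Nat.card (Fin d → ZMod p) := by
        rw [AddMonoidHom.range_eq_top.mpr hsurj, AddSubgroup.card_top]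
    _ = p ^ d := hcard_target

/-- **The higher one-units `U₂ = 1 + p² 𝒪_K ≃ₜ* ℤ_p^{[K:ℚ_p]}`** form an open subgroup of
finite index of `𝒪_K^×`, for a finite extension `K/ℚ_p` (as a local field) — Neukirch,
*Algebraic Number Theory* II (5.7) (i): "`U^{(n)} ≅ ℤ_p^d`, `d = [K:ℚ_p]`, for `n` sufficiently
large"; Serre, *Local Fields* XIV §4.  Proof: the tree's logarithm-free structure theorem
`OneUnits.exists_subgroup_continuousMulEquiv` for the compact `p`-adic ring `𝒪_K` (`p` is a
non-zero-divisor in the maximal ideal, `p^m 𝒪_K` is open, `⋂ p^m 𝒪_K = 0` by Krull) gives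
`U₂ ≃ₜ* ℤ_pⁿ` with `pⁿ = #(𝒪_K/p) = p^d`.  This is the `𝒪_K^×`-part of [AbsTopI] Thm 2.6 (ii)'s
`δ¹_p(G_k) = [k : ℚ_p] + 1`. [cite: MochizukiAbsTopI2012, Thm 2.6 (ii) p.21] -/
theorem exists_oneUnits_continuousMulEquiv :
    ∃ W : Subgroup (𝒪[K])ˣ, IsOpen (W : Set (𝒪[K])ˣ) ∧ W.FiniteIndex ∧
      Nonempty (W ≃ₜ* Multiplicative (Fin (Module.finrank ℚ_[p] K) → ℤ_[p])) := by
  classical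
  have hp : p.Prime := Fact.out
  haveI : CharZero K := charZero_of_injective_algebraMap (algebraMap ℚ_[p] K).injective
  haveI : T2Space K := by
    apply IsTopologicalAddGroup.t2Space_of_zero_sep
    intro x hx
    refine ⟨{ z | valuation K z < valuation K x }, ?_, by simp⟩
    rw [IsValuativeTopology.mem_nhds_zero_iff]
    exact ⟨Units.mk0 (valuation K x) (by simpa using hx), subset_rfl⟩
  have hpK : (p : K) ≠ 0 := by exact_mod_cast hp.ne_zero
  have hcoe : (((p : 𝒪[K]) : 𝒪[K]) : K) = (p : K) := by simp
  have hp_lt : valuation K (p : K) < 1 := LocalField.valuation_natCast_lt_one_of_algebra (K := K)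
  -- `p` is a non-zero-divisor
  have hreg : ∀ a : 𝒪[K], (p : 𝒪[K]) * a = 0 → a = 0 := by
    intro a ha
    rcases mul_eq_zero.mp ha with h | h
    · exact absurd (by simpa [hcoe] using congrArg (Subtype.val : 𝒪[K] → K) h) hpK
    · exact h
  -- `p` lies in the maximal ideal, so `1 + p a` is a unit
  have hpmax : (p : 𝒪[K]) ∈ IsLocalRing.maximalIdeal 𝒪[K] := by
    rw [IsLocalRing.mem_maximalIdeal, mem_nonunits_iff,
      Valuation.Integers.isUnit_iff_valuation_eq_one (Valuation.integer.integers _)]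
    change ¬ valuation K (((p : 𝒪[K]) : 𝒪[K]) : K) = 1
    rw [hcoe]
    exact hp_lt.ne
  have hunit : ∀ a : 𝒪[K], IsUnit (1 + (p : 𝒪[K]) * a) := by
    intro a
    rw [← IsLocalRing.notMem_maximalIdeal]
    intro hmem
    have hpa : (p : 𝒪[K]) * a ∈ IsLocalRing.maximalIdeal 𝒪[K] :=
      Ideal.mul_mem_right _ _ hpmax
    have h1 : (1 : 𝒪[K]) ∈ IsLocalRing.maximalIdeal 𝒪[K] := by
      have := Ideal.sub_mem _ hmem hpa
      rwa [add_sub_cancel_right] at this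
    exact (IsLocalRing.maximalIdeal.isMaximal 𝒪[K]).ne_top
      ((Ideal.eq_top_iff_one _).mpr h1)
  -- `p^m 𝒪_K` is open
  have hopen : ∀ m : ℕ, IsOpen ((Ideal.span {(p : 𝒪[K]) ^ m} : Ideal 𝒪[K]) : Set 𝒪[K]) := by
    intro m
    have hpm0 : (((p : 𝒪[K]) ^ m : 𝒪[K]) : K) ≠ 0 := by
      rw [Subring.coe_pow, hcoe]
      exact pow_ne_zero _ hpK
    set γ : ValueGroupWithZero K := valuation K ((((p : 𝒪[K]) ^ m : 𝒪[K]) : K)) with hγ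
    have hγ0 : γ ≠ 0 := by rw [hγ]; exact (Valuation.ne_zero_iff _).mpr hpm0
    -- the ideal, as an additive subgroup of `𝒪_K`, is a neighbourhood of `0`
    apply AddSubgroup.isOpen_of_mem_nhds ((Ideal.span {(p : 𝒪[K]) ^ m}).toAddSubgroup)
    have hT : {z : K | valuation K z < γ} ∈ 𝓝 (0 : K) := by
      rw [IsValuativeTopology.mem_nhds_zero_iff]
      exact ⟨Units.mk0 γ hγ0, subset_rfl⟩
    have hpre : ((↑) : 𝒪[K] → K) ⁻¹' {z : K | valuation K z < γ} ∈ 𝓝 (0 : 𝒪[K]) := by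
      apply continuous_subtype_val.continuousAt.preimage_mem_nhds
      simpa using hT
    refine Filter.mem_of_superset hpre ?_
    intro y hy
    simp only [Set.mem_preimage, Set.mem_setOf_eq] at hy
    change y ∈ Ideal.span {(p : 𝒪[K]) ^ m}
    rw [Ideal.mem_span_singleton]
    exact Valuation.Integers.dvd_of_le (Valuation.integer.integers (valuation K)) hy.le
  -- `⋂ p^m 𝒪_K = 0` (Krull)
  have hsep : ∀ a : 𝒪[K], (∀ m : ℕ, a ∈ Ideal.span {(p : 𝒪[K]) ^ m}) → a = 0 := by
    intro a ha
    have hne : (Ideal.span {(p : 𝒪[K])} : Ideal 𝒪[K]) ≠ ⊤ := by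
      intro h
      rw [Ideal.eq_top_iff_one, Ideal.mem_span_singleton] at h
      exact (IsLocalRing.maximalIdeal.isMaximal 𝒪[K]).ne_top
        ((Ideal.eq_top_iff_one _).mpr (Ideal.mem_of_dvd _ h hpmax))
    have hmem : a ∈ ⨅ m : ℕ, (Ideal.span {(p : 𝒪[K])} : Ideal 𝒪[K]) ^ m := by
      rw [Ideal.mem_iInf]
      intro m
      rw [Ideal.span_singleton_pow]
      exact ha m
    rw [Ideal.iInf_pow_eq_bot_of_isLocalRing _ hne] at hmem
    exact hmem
  obtain ⟨n, W, hcard, -, hWo, hWi, ⟨e⟩⟩ :=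
    OneUnits.exists_subgroup_continuousMulEquiv (A := 𝒪[K]) p hreg hunit hopen hsep
  have hn : n = Module.finrank ℚ_[p] K := by
    rw [natCard_integer_quot_span_prime p K] at hcard
    exact (Nat.pow_right_injective hp.two_le hcard).symm
  subst hn
  exact ⟨W, hWo, hWi, ⟨e⟩⟩

end Literature.AnabelianGeometry.AbsoluteAnabelian
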